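import Literature.Analysis.FluidPDE.FourierL2Convolution
import Literature.Analysis.FluidPDE.NSFourierAPriori
import HarnessLib

/-!
# Time-side estimates for the Fourier–Duhamel integral at a fixed frequency

Fourth file of the weighted-`L²` Fourier-side construction of the local smooth solution of the
Navier–Stokes system with `H¹`-controlled lifespan (discharge of
`Literature.Analysis.FluidPDE.tao2011_fourier_local_existence`; Tao 2013, Thm. 5.4 (ii)+(iv)).
At a fixed frequency `ξ` the Duhamel term of the transformed system is the time integral

  `D(t) = ∫₀ᵗ e^{-c‖ξ‖²(t-s)} N(s) ds`   (`FourierNS.heat c ξ (t - s) • N s`),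

and the projected nonlinearity carries one derivative, `‖N(s)‖ ≤ ‖ξ‖ φ(s)` (`FourierL2Nonlin`).
This file proves the three elementary time-side bounds through which the heat factor recovers
that derivative — the Fourier-side content of Tao's energy estimate for the Duhamel operator,
`‖∫₀ᵗ e^{(t-t')Δ} F‖_{X¹} ≲ ‖F‖_{L²_t H⁰}` (arXiv Lemma 23, (energy-duh2), p. 10), and of the
`L¹_t`-kernel gain with an exponential time weight used for the higher Sobolev norms
(tree `heatGain_le`, `div_le_inv_two_sqrt`):

* `enorm_duhamel_le_lintegral`: `‖D(t)‖ₑ ≤ ∫⁻_{(0,t]} e^{-c‖ξ‖²(t-s)} ‖N s‖ₑ ds`;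
* `enorm_duhamel_sq_le` (sup bound): `‖D(t)‖ₑ² ≤ (2c)⁻¹ ∫⁻_{(0,T]} φ²` for `t ∈ [0, T]`
  (Cauchy–Schwarz in time, `2c‖ξ‖² ∫ heat² ≤ 1`), and the low-frequency form
  `‖D(t)‖ₑ² ≤ ‖ξ‖² T ∫⁻_{(0,T]} φ²` (`enorm_duhamel_sq_le_low`);
* `lintegral_enorm_duhamel_sq_le` (`L²_t` bound, Schur):
  `c ‖ξ‖⁴ ∫⁻_{(0,T]} ‖D(t)‖ₑ² dt ≤ c⁻¹ ‖ξ‖² ∫⁻_{(0,T]} φ²`;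
* `exp_mul_enorm_duhamel_le` (weighted sup bound): if `e^{-λs} φ(s) ≤ Φ` on `[0, T]` then
  `e^{-λt} ‖D(t)‖ₑ ≤ Φ / (2√(cλ))`.

All statements are at a fixed frequency (a normed group element `ξ`), for an arbitrary
Banach-space-valued `N`, in `ℝ≥0∞` form (lower integrals over `Set.Ioc 0 T`), which is the form
integrated over `ξ` by Tonelli in the Picard iteration.

## Mathlib search

`intervalIntegral.integral_of_le`, `MeasureTheory.enorm_integral_le_lintegral_enorm`,
`MeasureTheory.ofReal_integral_eq_lintegral_ofReal`, `MeasureTheory.lintegral_lintegral_swap`,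
`MeasureTheory.Measure.prod_restrict`. Tree: `heat`, `integral_exp_neg_mul_sub_le`,
`div_le_inv_two_sqrt` (`NSFourierWeights`, `NSFourierPicard`),
`two_mul_norm_sq_mul_integral_heat_sq_le` (`NSFourierAPriori`), `sq_lintegral_mul_le`
(`FourierL2Convolution`).

## References

* T. Tao, Anal. PDE 6 (2013) = arXiv:1108.1165, §2, arXiv Lemma 23 (energy-duh2). [Tao2011]
* P. G. Lemarié-Rieusset, *The Navier–Stokes problem in the 21st century*, CRC 2016, §8.5.
-/

noncomputable section

open MeasureTheory Real Set Filter Function intervalIntegral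
open scoped ENNReal NNReal
open _root_.Topology

namespace Literature.Analysis.FluidPDE.FourierNS

variable {E : Type*} [NormedAddCommGroup E]
variable {F : Type*} [NormedAddCommGroup F] [NormedSpace ℝ F]

/-! ### The Duhamel integral dominated by a lower integral -/

/-- **`‖∫₀ᵗ heat(t-s) • N(s) ds‖ₑ ≤ ∫⁻_{(0,t]} heat(t-s) ‖N(s)‖ₑ ds`** for `0 ≤ t`. [folklore] -/
theorem enorm_duhamel_le_lintegral (c : ℝ) (ξ : E) (N : ℝ → F) {t : ℝ} (ht : 0 ≤ t) :
    ‖∫ s in (0 : ℝ)..t, heat c ξ (t - s) • N s‖ₑ ≤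
      ∫⁻ s in Ioc 0 t, ENNReal.ofReal (heat c ξ (t - s)) * ‖N s‖ₑ := by
  rw [intervalIntegral.integral_of_le ht]
  refine (enorm_integral_le_lintegral_enorm _).trans (le_of_eq (lintegral_congr fun s => ?_))
  rw [enorm_smul, Real.enorm_eq_ofReal (heat_nonneg c ξ _)]

/-- The lower integral of a non-negative continuous function over `(0, t]` is the interval
integral. [folklore] -/
theorem lintegral_Ioc_ofReal_eq_ofReal_integral {g : ℝ → ℝ} (hg : Continuous g)
    (hg0 : ∀ s, 0 ≤ g s) {a t : ℝ} (hat : a ≤ t) :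
    ∫⁻ s in Ioc a t, ENNReal.ofReal (g s) = ENNReal.ofReal (∫ s in a..t, g s) := by
  rw [intervalIntegral.integral_of_le hat, ofReal_integral_eq_lintegral_ofReal
    (hg.integrableOn_Icc.mono_set Ioc_subset_Icc_self) (Eventually.of_forall fun s => hg0 s)]

/-! ### The sup bound (Cauchy–Schwarz in time) -/

variable {c T : ℝ} {ξ : E} {N : ℝ → F} {φ : ℝ → ℝ≥0∞}

/-- **Energy estimate, sup part.** If `‖N(s)‖ₑ ≤ ‖ξ‖ φ(s)` on `[0, T]` (`φ` measurable) then for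
`t ∈ [0, T]` and `c > 0`,
`‖∫₀ᵗ heat(t-s) • N(s) ds‖ₑ² ≤ (2c)⁻¹ ∫⁻_{(0,T]} φ²` — Cauchy–Schwarz in time and
`2c‖ξ‖² ∫₀ᵗ heat(t-s)² ds ≤ 1`: the heat factor recovers the derivative in the nonlinearity
uniformly in the frequency (Tao 2013, arXiv Lemma 23, (energy-duh2), Fourier form).
[cite: Tao2011, Lemma 2.1 (arXiv Lemma 23)] -/
theorem enorm_duhamel_sq_le (hc : 0 < c) (hφ : AEMeasurable φ (volume.restrict (Ioc 0 T)))
    (hN : ∀ s ∈ Icc 0 T, ‖N s‖ₑ ≤ ENNReal.ofReal ‖ξ‖ * φ s) {t : ℝ} (ht : t ∈ Icc 0 T) :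
    ‖∫ s in (0 : ℝ)..t, heat c ξ (t - s) • N s‖ₑ ^ 2 ≤
      ENNReal.ofReal (1 / (2 * c)) * ∫⁻ s in Ioc 0 T, φ s ^ 2 := by
  have ht0 : 0 ≤ t := ht.1
  have hsub : Ioc 0 t ⊆ Ioc 0 T := Ioc_subset_Ioc_right ht.2
  -- kernel `k(s) = heat(t-s) ‖ξ‖`
  set k : ℝ → ℝ≥0∞ := fun s => ENNReal.ofReal (heat c ξ (t - s) * ‖ξ‖) with hk
  have hkm : AEMeasurable k (volume.restrict (Ioc 0 t)) :=
    (ENNReal.continuous_ofReal.comp (by unfold heat; fun_prop)).measurable.aemeasurable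
  have hφt : AEMeasurable φ (volume.restrict (Ioc 0 t)) := hφ.mono_measure
    (Measure.restrict_mono hsub le_rfl)
  have h1 : ‖∫ s in (0 : ℝ)..t, heat c ξ (t - s) • N s‖ₑ ≤ ∫⁻ s in Ioc 0 t, k s * φ s := by
    refine (enorm_duhamel_le_lintegral c ξ N ht0).trans (setLIntegral_mono' measurableSet_Ioc
      fun s hs => ?_)
    calc ENNReal.ofReal (heat c ξ (t - s)) * ‖N s‖ₑ
        ≤ ENNReal.ofReal (heat c ξ (t - s)) * (ENNReal.ofReal ‖ξ‖ * φ s) := by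
          gcongr; exact hN s ⟨hs.1.le, hs.2.trans ht.2⟩
      _ = k s * φ s := by
          rw [hk, ← mul_assoc, ← ENNReal.ofReal_mul (heat_nonneg c ξ _)]
  have h2 : (∫⁻ s in Ioc 0 t, k s * φ s) ^ 2 ≤
      (∫⁻ s in Ioc 0 t, k s ^ 2) * ∫⁻ s in Ioc 0 t, φ s ^ 2 := sq_lintegral_mul_le _ hkm hφt
  have h3 : ∫⁻ s in Ioc 0 t, k s ^ 2 ≤ ENNReal.ofReal (1 / (2 * c)) := by
    have hcont : Continuous fun s => (heat c ξ (t - s) * ‖ξ‖) ^ 2 := by unfold heat; fun_prop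
    calc ∫⁻ s in Ioc 0 t, k s ^ 2 = ∫⁻ s in Ioc 0 t, ENNReal.ofReal ((heat c ξ (t - s) * ‖ξ‖) ^ 2) :=
          lintegral_congr fun s => by
            rw [hk, ENNReal.ofReal_pow (mul_nonneg (heat_nonneg c ξ _) (norm_nonneg _))]
      _ = ENNReal.ofReal (∫ s in (0 : ℝ)..t, (heat c ξ (t - s) * ‖ξ‖) ^ 2) :=
          lintegral_Ioc_ofReal_eq_ofReal_integral hcont (fun s => sq_nonneg _) ht0
      _ ≤ ENNReal.ofReal (1 / (2 * c)) := by
          refine ENNReal.ofReal_le_ofReal ?_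
          have h := two_mul_norm_sq_mul_integral_heat_sq_le c ξ 0 t
          have heq : ∫ s in (0 : ℝ)..t, (heat c ξ (t - s) * ‖ξ‖) ^ 2 =
              ‖ξ‖ ^ 2 * ∫ s in (0 : ℝ)..t, heat c ξ (t - s) ^ 2 := by
            rw [← intervalIntegral.integral_const_mul]
            exact intervalIntegral.integral_congr fun s _ => by ring
          rw [heq, le_div_iff₀ (by positivity)]
          nlinarith [h]
  calc ‖∫ s in (0 : ℝ)..t, heat c ξ (t - s) • N s‖ₑ ^ 2 ≤ (∫⁻ s in Ioc 0 t, k s * φ s) ^ 2 :=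
        pow_le_pow_left' h1 2
    _ ≤ (∫⁻ s in Ioc 0 t, k s ^ 2) * ∫⁻ s in Ioc 0 t, φ s ^ 2 := h2
    _ ≤ ENNReal.ofReal (1 / (2 * c)) * ∫⁻ s in Ioc 0 T, φ s ^ 2 :=
        mul_le_mul' h3 (lintegral_mono_set hsub)

/-- **Low-frequency sup bound.** Under the same hypotheses (any real `c ≥ 0`),
`‖∫₀ᵗ heat(t-s) • N(s) ds‖ₑ² ≤ ‖ξ‖² T ∫⁻_{(0,T]} φ²` (`heat ≤ 1` and Cauchy–Schwarz): the
Duhamel term is small at low frequencies, which controls its `L²_ξ` size without the heat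
gain. [folklore] -/
theorem enorm_duhamel_sq_le_low (hc : 0 ≤ c) (hφ : AEMeasurable φ (volume.restrict (Ioc 0 T)))
    (hN : ∀ s ∈ Icc 0 T, ‖N s‖ₑ ≤ ENNReal.ofReal ‖ξ‖ * φ s) {t : ℝ} (ht : t ∈ Icc 0 T) :
    ‖∫ s in (0 : ℝ)..t, heat c ξ (t - s) • N s‖ₑ ^ 2 ≤
      ENNReal.ofReal (‖ξ‖ ^ 2 * T) * ∫⁻ s in Ioc 0 T, φ s ^ 2 := by
  have ht0 : 0 ≤ t := ht.1
  have hsub : Ioc 0 t ⊆ Ioc 0 T := Ioc_subset_Ioc_right ht.2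
  have hφt : AEMeasurable φ (volume.restrict (Ioc 0 t)) := hφ.mono_measure
    (Measure.restrict_mono hsub le_rfl)
  have h1 : ‖∫ s in (0 : ℝ)..t, heat c ξ (t - s) • N s‖ₑ ≤
      ∫⁻ s in Ioc 0 t, ENNReal.ofReal ‖ξ‖ * φ s := by
    refine (enorm_duhamel_le_lintegral c ξ N ht0).trans (setLIntegral_mono' measurableSet_Ioc
      fun s hs => ?_)
    calc ENNReal.ofReal (heat c ξ (t - s)) * ‖N s‖ₑ ≤ 1 * (ENNReal.ofReal ‖ξ‖ * φ s) := by
          gcongr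
          · rw [← ENNReal.ofReal_one]
            exact ENNReal.ofReal_le_ofReal (heat_le_one hc (by linarith [hs.2]) ξ)
          · exact hN s ⟨hs.1.le, hs.2.trans ht.2⟩
      _ = ENNReal.ofReal ‖ξ‖ * φ s := one_mul _
  have h2 : (∫⁻ s in Ioc 0 t, ENNReal.ofReal ‖ξ‖ * φ s) ^ 2 ≤
      (∫⁻ _s in Ioc 0 t, ENNReal.ofReal ‖ξ‖ ^ 2) * ∫⁻ s in Ioc 0 t, φ s ^ 2 :=
    sq_lintegral_mul_le _ aemeasurable_const hφt
  calc ‖∫ s in (0 : ℝ)..t, heat c ξ (t - s) • N s‖ₑ ^ 2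
      ≤ (∫⁻ s in Ioc 0 t, ENNReal.ofReal ‖ξ‖ * φ s) ^ 2 := pow_le_pow_left' h1 2
    _ ≤ (∫⁻ _s in Ioc 0 t, ENNReal.ofReal ‖ξ‖ ^ 2) * ∫⁻ s in Ioc 0 t, φ s ^ 2 := h2
    _ ≤ ENNReal.ofReal (‖ξ‖ ^ 2 * T) * ∫⁻ s in Ioc 0 T, φ s ^ 2 := by
        refine mul_le_mul' ?_ (lintegral_mono_set hsub)
        rw [setLIntegral_const, Real.volume_Ioc, ← ENNReal.ofReal_pow (norm_nonneg _), mul_comm,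
          ← ENNReal.ofReal_mul (by linarith)]
        exact ENNReal.ofReal_le_ofReal (by nlinarith [ht.2, sq_nonneg ‖ξ‖])

/-! ### The `L²`-in-time bound (Schur) -/

/-- `∫⁻_{(a,t]} e^{-γ(t-s)} ds ≤ γ⁻¹` for `γ > 0`, `a ≤ t`. [folklore] -/
theorem lintegral_Ioc_exp_neg_mul_sub_le {γ a t : ℝ} (hγ : 0 < γ) (hat : a ≤ t) :
    ∫⁻ s in Ioc a t, ENNReal.ofReal (Real.exp (-γ * (t - s))) ≤ ENNReal.ofReal (1 / γ) := by
  rw [lintegral_Ioc_ofReal_eq_ofReal_integral (by fun_prop) (fun s => (Real.exp_pos _).le) hat]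
  refine ENNReal.ofReal_le_ofReal ?_
  have hderiv : ∀ s ∈ Set.uIcc a t,
      HasDerivAt (fun s => Real.exp (-γ * (t - s)) / γ) (Real.exp (-γ * (t - s))) s := by
    intro s _
    have h1 : HasDerivAt (fun s => -γ * (t - s)) γ s := by
      simpa using ((hasDerivAt_id s).const_sub t).const_mul (-γ)
    have h2 := (h1.exp).div_const γ
    have h3 : Real.exp (-γ * (t - s)) * γ / γ = Real.exp (-γ * (t - s)) := by
      rw [mul_div_assoc, div_self hγ.ne', mul_one]
    rw [h3] at h2
    exact h2
  have hcont : Continuous fun s => Real.exp (-γ * (t - s)) := by fun_prop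
  rw [intervalIntegral.integral_eq_sub_of_hasDerivAt hderiv (hcont.intervalIntegrable _ _)]
  simp only [sub_self, mul_zero, Real.exp_zero]
  have : 0 ≤ Real.exp (-γ * (t - a)) / γ := by positivity
  linarith

/-- `∫⁻_{(s,T]} e^{-γ(t-s)} dt ≤ γ⁻¹` for `γ > 0`, `s ≤ T` (the transposed kernel integral).
[folklore] -/
theorem lintegral_Ioc_exp_neg_mul_sub_le' {γ s T : ℝ} (hγ : 0 < γ) (hsT : s ≤ T) :
    ∫⁻ t in Ioc s T, ENNReal.ofReal (Real.exp (-γ * (t - s))) ≤ ENNReal.ofReal (1 / γ) := by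
  rw [lintegral_Ioc_ofReal_eq_ofReal_integral (by fun_prop) (fun t => (Real.exp_pos _).le) hsT]
  refine ENNReal.ofReal_le_ofReal ?_
  have hderiv : ∀ t ∈ Set.uIcc s T,
      HasDerivAt (fun t => -Real.exp (-γ * (t - s)) / γ) (Real.exp (-γ * (t - s))) t := by
    intro t _
    have h1 : HasDerivAt (fun t => -γ * (t - s)) (-γ) t := by
      simpa using ((hasDerivAt_id t).sub_const s).const_mul (-γ)
    have h2 := (h1.exp.neg).div_const γ
    have h3 : -(Real.exp (-γ * (t - s)) * -γ) / γ = Real.exp (-γ * (t - s)) := by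
      field_simp
    rw [h3] at h2
    exact h2
  have hcont : Continuous fun t => Real.exp (-γ * (t - s)) := by fun_prop
  rw [intervalIntegral.integral_eq_sub_of_hasDerivAt hderiv (hcont.intervalIntegrable _ _)]
  simp only [sub_self, mul_zero, Real.exp_zero]
  have : 0 ≤ Real.exp (-γ * (T - s)) / γ := by positivity
  rw [neg_div, neg_div, sub_neg_eq_add]
  linarith

/-- **Energy estimate, `L²_t` part (Schur's bound).** If `‖N(s)‖ₑ ≤ ‖ξ‖ φ(s)` on `[0, T]`
(`φ` measurable) and `c > 0`, then
`c ‖ξ‖⁴ ∫⁻_{(0,T]} ‖∫₀ᵗ heat(t-s) • N(s) ds‖ₑ² dt ≤ c⁻¹ ‖ξ‖² ∫⁻_{(0,T]} φ²`: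
with the kernel `K(τ) = e^{-c‖ξ‖²τ}`, `‖K‖_{L¹} ≤ (c‖ξ‖²)⁻¹`, Cauchy–Schwarz with the weight
`K(t-s)` and Tonelli on the triangle `0 < s ≤ t ≤ T` give
`∫‖D‖² ≤ ‖K‖₁² ∫ ‖N‖² ≤ (c‖ξ‖²)⁻² ‖ξ‖² ∫ φ²` (Tao 2013, arXiv Lemma 23, (energy-duh2): the
`L²_t Ḣ^{s+1}` half of the `X^s` norm of the Duhamel term). [cite: Tao2011, Lemma 2.1 (arXiv Lemma 23)] -/
theorem lintegral_enorm_duhamel_sq_le (hc : 0 < c)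
    (hNm : AEStronglyMeasurable N (volume.restrict (Ioc 0 T)))
    (hφ : AEMeasurable φ (volume.restrict (Ioc 0 T)))
    (hN : ∀ s ∈ Icc 0 T, ‖N s‖ₑ ≤ ENNReal.ofReal ‖ξ‖ * φ s) :
    ENNReal.ofReal (c * ‖ξ‖ ^ 4) * ∫⁻ t in Ioc 0 T, ‖∫ s in (0 : ℝ)..t, heat c ξ (t - s) • N s‖ₑ ^ 2 ≤
      ENNReal.ofReal (c⁻¹ * ‖ξ‖ ^ 2) * ∫⁻ s in Ioc 0 T, φ s ^ 2 := by
  -- the degenerate frequency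
  rcases eq_or_ne ‖ξ‖ 0 with hξ | hξ
  · simp [hξ]
  have hr : 0 < ‖ξ‖ := lt_of_le_of_ne (norm_nonneg _) (Ne.symm hξ)
  set γ : ℝ := c * ‖ξ‖ ^ 2 with hγ
  have hγ0 : 0 < γ := by positivity
  -- the kernel on the triangle, as a function of `(t, s)`
  set K : ℝ → ℝ → ℝ≥0∞ := fun t s =>
    (Ioc 0 t).indicator (fun s => ENNReal.ofReal (Real.exp (-γ * (t - s)))) s with hK
  have hheat : ∀ t s, heat c ξ (t - s) = Real.exp (-γ * (t - s)) := fun t s => by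
    rw [heat, hγ]
  have hKm : Measurable (uncurry K) := by
    have hset : MeasurableSet {p : ℝ × ℝ | p.2 ∈ Ioc 0 p.1} :=
      (measurableSet_lt measurable_const measurable_snd).inter
        (measurableSet_le measurable_snd measurable_fst)
    have hf : Measurable fun p : ℝ × ℝ => ENNReal.ofReal (Real.exp (-γ * (p.1 - p.2))) :=
      (ENNReal.continuous_ofReal.comp (by fun_prop)).measurable
    have : uncurry K = fun p : ℝ × ℝ => {p : ℝ × ℝ | p.2 ∈ Ioc 0 p.1}.indicator
        (fun p => ENNReal.ofReal (Real.exp (-γ * (p.1 - p.2)))) p := by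
      funext p
      simp only [uncurry, hK, indicator, mem_setOf_eq]
    rw [this]
    exact hf.indicator hset
  -- Step 1: pointwise Schur bound at each `t ∈ (0, T]`
  have hpt : ∀ t ∈ Ioc 0 T, ‖∫ s in (0 : ℝ)..t, heat c ξ (t - s) • N s‖ₑ ^ 2 ≤
      ENNReal.ofReal (1 / γ) * ∫⁻ s in Ioc 0 T, K t s * ‖N s‖ₑ ^ 2 := by
    intro t ht
    have ht0 : 0 ≤ t := ht.1.le
    have hsub : Ioc 0 t ⊆ Ioc 0 T := Ioc_subset_Ioc_right ht.2
    have hNt : AEStronglyMeasurable N (volume.restrict (Ioc 0 t)) :=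
      hNm.mono_measure (Measure.restrict_mono hsub le_rfl)
    set R : ℝ → ℝ≥0∞ := fun s => (ENNReal.ofReal (Real.exp (-γ * (t - s)))) ^ (1 / 2 : ℝ) with hR
    have hRm : AEMeasurable R (volume.restrict (Ioc 0 t)) :=
      ((ENNReal.continuous_ofReal.comp (by fun_prop)).measurable.pow_const _).aemeasurable
    have hR2 : ∀ s, R s ^ 2 = ENNReal.ofReal (Real.exp (-γ * (t - s))) := fun s => by
      rw [hR, ← ENNReal.rpow_natCast, ← ENNReal.rpow_mul]; norm_num
    have h1 : ‖∫ s in (0 : ℝ)..t, heat c ξ (t - s) • N s‖ₑ ≤ ∫⁻ s in Ioc 0 t, R s * (R s * ‖N s‖ₑ) := by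
      refine (enorm_duhamel_le_lintegral c ξ N ht0).trans (le_of_eq (lintegral_congr fun s => ?_))
      rw [← mul_assoc, ← sq, hR2, hheat]
    calc ‖∫ s in (0 : ℝ)..t, heat c ξ (t - s) • N s‖ₑ ^ 2
        ≤ (∫⁻ s in Ioc 0 t, R s * (R s * ‖N s‖ₑ)) ^ 2 := pow_le_pow_left' h1 2
      _ ≤ (∫⁻ s in Ioc 0 t, R s ^ 2) * ∫⁻ s in Ioc 0 t, (R s * ‖N s‖ₑ) ^ 2 :=
          sq_lintegral_mul_le _ hRm (hRm.mul hNt.enorm)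
      _ ≤ ENNReal.ofReal (1 / γ) * ∫⁻ s in Ioc 0 T, K t s * ‖N s‖ₑ ^ 2 := by
          refine mul_le_mul' ?_ ?_
          · calc ∫⁻ s in Ioc 0 t, R s ^ 2 = ∫⁻ s in Ioc 0 t, ENNReal.ofReal (Real.exp (-γ * (t - s))) :=
                  lintegral_congr fun s => hR2 s
              _ ≤ ENNReal.ofReal (1 / γ) := lintegral_Ioc_exp_neg_mul_sub_le hγ0 ht0
          · calc ∫⁻ s in Ioc 0 t, (R s * ‖N s‖ₑ) ^ 2
                = ∫⁻ s in Ioc 0 t, K t s * ‖N s‖ₑ ^ 2 := by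
                  refine setLIntegral_congr_fun measurableSet_Ioc fun s hs => ?_
                  rw [mul_pow, hR2, hK]
                  simp only [indicator_of_mem hs]
              _ ≤ ∫⁻ s in Ioc 0 T, K t s * ‖N s‖ₑ ^ 2 := lintegral_mono_set hsub
  -- Step 2: integrate in `t` and swap (Tonelli on the triangle)
  have hswap : ∫⁻ t in Ioc 0 T, ∫⁻ s in Ioc 0 T, K t s * ‖N s‖ₑ ^ 2 =
      ∫⁻ s in Ioc 0 T, ‖N s‖ₑ ^ 2 * ∫⁻ t in Ioc 0 T, K t s := by
    rw [lintegral_lintegral_swap]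
    · refine lintegral_congr fun s => ?_
      have hmeas : AEMeasurable (fun t => K t s) (volume.restrict (Ioc 0 T)) :=
        (hKm.comp (measurable_id.prodMk measurable_const)).aemeasurable
      rw [lintegral_mul_const'' _ hmeas, mul_comm]
    · have h1 : AEMeasurable (fun p : ℝ × ℝ => K p.1 p.2)
          ((volume.restrict (Ioc 0 T)).prod (volume.restrict (Ioc 0 T))) := hKm.aemeasurable
      have h2 : AEMeasurable (fun p : ℝ × ℝ => ‖N p.2‖ₑ ^ 2)
          ((volume.restrict (Ioc 0 T)).prod (volume.restrict (Ioc 0 T))) :=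
        ((hNm.enorm.pow_const 2).comp_quasiMeasurePreserving Measure.quasiMeasurePreserving_snd)
      exact h1.mul h2
  have hinner : ∀ s ∈ Ioc 0 T, ∫⁻ t in Ioc 0 T, K t s ≤ ENNReal.ofReal (1 / γ) := by
    intro s hs
    set g : ℝ → ℝ≥0∞ := fun t => ENNReal.ofReal (Real.exp (-γ * (t - s))) with hg
    have hKeq : ∀ t, K t s = (Ici s).indicator g t := by
      intro t
      simp only [hK, hg, indicator, mem_Ioc, mem_Ici]
      by_cases hst : s ≤ t
      · rw [if_pos ⟨hs.1, hst⟩, if_pos hst]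
      · rw [if_neg (fun h => hst h.2), if_neg hst]
    have hset : Ici s ∩ Ioc 0 T = Icc s T := Set.ext fun t =>
      ⟨fun h => ⟨h.1, h.2.2⟩, fun h => ⟨h.1, lt_of_lt_of_le hs.1 h.1, h.2⟩⟩
    calc ∫⁻ t in Ioc 0 T, K t s = ∫⁻ t in Ioc 0 T, (Ici s).indicator g t :=
          lintegral_congr fun t => hKeq t
      _ = ∫⁻ t in Icc s T, g t := by
          rw [lintegral_indicator measurableSet_Ici, Measure.restrict_restrict measurableSet_Ici, hset]
      _ = ∫⁻ t in Ioc s T, g t := setLIntegral_congr Ioc_ae_eq_Icc.symm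
      _ ≤ ENNReal.ofReal (1 / γ) := lintegral_Ioc_exp_neg_mul_sub_le' hγ0 hs.2
  -- Step 3: assemble
  have hmain : ∫⁻ t in Ioc 0 T, ‖∫ s in (0 : ℝ)..t, heat c ξ (t - s) • N s‖ₑ ^ 2 ≤
      ENNReal.ofReal (1 / γ) * (ENNReal.ofReal (1 / γ) * ∫⁻ s in Ioc 0 T, ‖N s‖ₑ ^ 2) := by
    calc ∫⁻ t in Ioc 0 T, ‖∫ s in (0 : ℝ)..t, heat c ξ (t - s) • N s‖ₑ ^ 2
        ≤ ∫⁻ t in Ioc 0 T, ENNReal.ofReal (1 / γ) * ∫⁻ s in Ioc 0 T, K t s * ‖N s‖ₑ ^ 2 :=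
          setLIntegral_mono' measurableSet_Ioc hpt
      _ = ENNReal.ofReal (1 / γ) * ∫⁻ s in Ioc 0 T, ‖N s‖ₑ ^ 2 * ∫⁻ t in Ioc 0 T, K t s := by
          rw [lintegral_const_mul' _ _ ENNReal.ofReal_ne_top, hswap]
      _ ≤ ENNReal.ofReal (1 / γ) * ∫⁻ s in Ioc 0 T, ‖N s‖ₑ ^ 2 * ENNReal.ofReal (1 / γ) :=
          mul_le_mul' le_rfl (setLIntegral_mono' measurableSet_Ioc fun s hs =>
            mul_le_mul' le_rfl (hinner s hs))
      _ = ENNReal.ofReal (1 / γ) * (ENNReal.ofReal (1 / γ) * ∫⁻ s in Ioc 0 T, ‖N s‖ₑ ^ 2) := by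
          rw [lintegral_mul_const' _ _ ENNReal.ofReal_ne_top, mul_comm (∫⁻ s in Ioc 0 T, ‖N s‖ₑ ^ 2)]
  have hN2 : ∫⁻ s in Ioc 0 T, ‖N s‖ₑ ^ 2 ≤ ENNReal.ofReal (‖ξ‖ ^ 2) * ∫⁻ s in Ioc 0 T, φ s ^ 2 := by
    rw [← lintegral_const_mul'' _ (hφ.pow_const 2)]
    refine setLIntegral_mono' measurableSet_Ioc fun s hs => ?_
    calc ‖N s‖ₑ ^ 2 ≤ (ENNReal.ofReal ‖ξ‖ * φ s) ^ 2 := pow_le_pow_left' (hN s ⟨hs.1.le, hs.2⟩) 2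
      _ = ENNReal.ofReal (‖ξ‖ ^ 2) * φ s ^ 2 := by rw [mul_pow, ENNReal.ofReal_pow (norm_nonneg _)]
  calc ENNReal.ofReal (c * ‖ξ‖ ^ 4) * ∫⁻ t in Ioc 0 T, ‖∫ s in (0 : ℝ)..t, heat c ξ (t - s) • N s‖ₑ ^ 2
      ≤ ENNReal.ofReal (c * ‖ξ‖ ^ 4) * (ENNReal.ofReal (1 / γ) * (ENNReal.ofReal (1 / γ) *
          (ENNReal.ofReal (‖ξ‖ ^ 2) * ∫⁻ s in Ioc 0 T, φ s ^ 2))) :=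
        mul_le_mul' le_rfl (hmain.trans (mul_le_mul' le_rfl (mul_le_mul' le_rfl hN2)))
    _ = ENNReal.ofReal (c * ‖ξ‖ ^ 4 * (1 / γ) * (1 / γ) * ‖ξ‖ ^ 2) * ∫⁻ s in Ioc 0 T, φ s ^ 2 := by
        rw [← mul_assoc, ← mul_assoc, ← mul_assoc,
          ← ENNReal.ofReal_mul (p := c * ‖ξ‖ ^ 4) (by positivity),
          ← ENNReal.ofReal_mul (p := c * ‖ξ‖ ^ 4 * (1 / γ)) (by positivity),
          ← ENNReal.ofReal_mul (p := c * ‖ξ‖ ^ 4 * (1 / γ) * (1 / γ)) (by positivity)]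
    _ = ENNReal.ofReal (c⁻¹ * ‖ξ‖ ^ 2) * ∫⁻ s in Ioc 0 T, φ s ^ 2 := by
        congr 2
        rw [hγ]
        field_simp

/-! ### The exponentially weighted sup bound (`L¹_t` kernel gain) -/

/-- **Weighted sup bound.** If `‖N(s)‖ₑ ≤ ‖ξ‖ φ(s)` and `e^{-λs} φ(s) ≤ Φ` on `[0, T]`, then
for `t ∈ [0, T]`, `c, λ > 0`,
`e^{-λt} ‖∫₀ᵗ heat(t-s) • N(s) ds‖ₑ ≤ Φ / (2√(cλ))`:
`e^{-λt} heat(t-s) ‖ξ‖ = ‖ξ‖ e^{-(c‖ξ‖²+λ)(t-s)} · e^{-λs}` and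
`‖ξ‖ ∫₀ᵗ e^{-(c‖ξ‖²+λ)τ} dτ ≤ ‖ξ‖/(c‖ξ‖²+λ) ≤ 1/(2√(cλ))` (tree `div_le_inv_two_sqrt`): the heat
factor's `L¹_t` mass recovers the derivative with a gain `λ^{-1/2}`, uniformly in the frequency
(Lemarié-Rieusset 2016, §8.5; the device by which all higher Sobolev norms are propagated on the
full interval of existence). [folklore] -/
theorem exp_mul_enorm_duhamel_le (hc : 0 < c) {lam : ℝ} (hlam : 0 < lam) {Φ : ℝ≥0∞}
    (hN : ∀ s ∈ Icc 0 T, ‖N s‖ₑ ≤ ENNReal.ofReal ‖ξ‖ * φ s)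
    (hΦ : ∀ s ∈ Icc 0 T, ENNReal.ofReal (Real.exp (-lam * s)) * φ s ≤ Φ) {t : ℝ} (ht : t ∈ Icc 0 T) :
    ENNReal.ofReal (Real.exp (-lam * t)) * ‖∫ s in (0 : ℝ)..t, heat c ξ (t - s) • N s‖ₑ ≤
      ENNReal.ofReal (1 / (2 * Real.sqrt (c * lam))) * Φ := by
  have ht0 : 0 ≤ t := ht.1
  set β : ℝ := c * ‖ξ‖ ^ 2 + lam with hβ
  have hβ0 : 0 < β := by positivity
  -- the weighted kernel
  set k : ℝ → ℝ≥0∞ := fun s => ENNReal.ofReal (‖ξ‖ * Real.exp (-β * (t - s))) with hk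
  have hkm : AEMeasurable k (volume.restrict (Ioc 0 t)) :=
    (ENNReal.continuous_ofReal.comp (by fun_prop)).measurable.aemeasurable
  have hX : ∀ s, Real.exp (-lam * t) * heat c ξ (t - s) * ‖ξ‖ =
      ‖ξ‖ * Real.exp (-β * (t - s)) * Real.exp (-lam * s) := by
    intro s
    simp only [heat, hβ]
    rw [← Real.exp_add, mul_assoc ‖ξ‖, ← Real.exp_add, mul_comm ‖ξ‖]
    congr 2
    ring
  have hsplit : ∀ s, ENNReal.ofReal (Real.exp (-lam * t)) * (ENNReal.ofReal (heat c ξ (t - s)) *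
      (ENNReal.ofReal ‖ξ‖ * φ s)) = k s * (ENNReal.ofReal (Real.exp (-lam * s)) * φ s) := by
    intro s
    calc ENNReal.ofReal (Real.exp (-lam * t)) * (ENNReal.ofReal (heat c ξ (t - s)) *
        (ENNReal.ofReal ‖ξ‖ * φ s))
        = ENNReal.ofReal (Real.exp (-lam * t) * heat c ξ (t - s) * ‖ξ‖) * φ s := by
          rw [ENNReal.ofReal_mul (mul_nonneg (Real.exp_pos _).le (heat_nonneg c ξ _)),
            ENNReal.ofReal_mul (Real.exp_pos _).le]
          ring
      _ = ENNReal.ofReal (‖ξ‖ * Real.exp (-β * (t - s)) * Real.exp (-lam * s)) * φ s := by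
          rw [hX s]
      _ = k s * (ENNReal.ofReal (Real.exp (-lam * s)) * φ s) := by
          rw [hk, ENNReal.ofReal_mul (by positivity)]
          ring
  calc ENNReal.ofReal (Real.exp (-lam * t)) * ‖∫ s in (0 : ℝ)..t, heat c ξ (t - s) • N s‖ₑ
      ≤ ENNReal.ofReal (Real.exp (-lam * t)) *
          ∫⁻ s in Ioc 0 t, ENNReal.ofReal (heat c ξ (t - s)) * (ENNReal.ofReal ‖ξ‖ * φ s) := by
        gcongr
        refine (enorm_duhamel_le_lintegral c ξ N ht0).trans (setLIntegral_mono' measurableSet_Ioc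
          fun s hs => ?_)
        gcongr; exact hN s ⟨hs.1.le, hs.2.trans ht.2⟩
    _ = ∫⁻ s in Ioc 0 t, k s * (ENNReal.ofReal (Real.exp (-lam * s)) * φ s) := by
        rw [← lintegral_const_mul' _ _ ENNReal.ofReal_ne_top]
        exact lintegral_congr fun s => hsplit s
    _ ≤ ∫⁻ s in Ioc 0 t, k s * Φ := setLIntegral_mono' measurableSet_Ioc fun s hs => by
        gcongr; exact hΦ s ⟨hs.1.le, hs.2.trans ht.2⟩
    _ = (∫⁻ s in Ioc 0 t, k s) * Φ := lintegral_mul_const'' _ hkm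
    _ ≤ ENNReal.ofReal (1 / (2 * Real.sqrt (c * lam))) * Φ := by
        gcongr
        calc ∫⁻ s in Ioc 0 t, k s = ENNReal.ofReal (∫ s in (0 : ℝ)..t, ‖ξ‖ * Real.exp (-β * (t - s))) :=
              lintegral_Ioc_ofReal_eq_ofReal_integral (by fun_prop) (fun s => by positivity) ht0
          _ ≤ ENNReal.ofReal (1 / (2 * Real.sqrt (c * lam))) := by
              refine ENNReal.ofReal_le_ofReal ?_
              rw [intervalIntegral.integral_const_mul]
              calc ‖ξ‖ * ∫ s in (0 : ℝ)..t, Real.exp (-β * (t - s)) ≤ ‖ξ‖ * (1 / β) :=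
                    mul_le_mul_of_nonneg_left (integral_exp_neg_mul_sub_le hβ0) (norm_nonneg _)
                _ = ‖ξ‖ / (c * ‖ξ‖ ^ 2 + lam) := by rw [hβ]; ring
                _ ≤ 1 / (2 * Real.sqrt (c * lam)) := div_le_inv_two_sqrt hc hlam

end Literature.Analysis.FluidPDE.FourierNS

end
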